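import Mathlib
import HarnessLib
import HarnessLib.Audit
import Summits.Langlands.Statement
import Summits.Langlands.Langlands.Theses.SymmetryTypeSplit
import Summits.Langlands.Langlands.Theses.SkinnerWilesDefectOne
import Summits.Langlands.Langlands.Theses.EllipticTraceSplit
import Literature.NumberTheory.Automorphic.CaraianiNewtonModularity

/-!
# Elliptic-trace split of GEN (lens-2 g19, REV 1) — kernel TWIN of the born route `EllipticTraceSplit` (74th cell route)
# + census SECOND READ of the two junction schemas (instruments I-g19.1 `EllipticDictionary`, I-g19.2 `TwistTransport`; critic rule p1)

Decomposition node of the Langlands root ladder (cell decomp-langlands; RESIDUAL MODE, BLOCKER FIRST).  TARGET = GEN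
`Summit.Langlands.Langlands.Theses.SymmetryTypeSplit.GenericProModular` (stmt-Langlands-27289, the declared residual r4 of
route-Langlands-SymmetryTypeSplit, itself the generic cell of the host BLOCKER E = `SkinnerWilesDefectOne.ReducibleOrdinaryProModular`
stmt-Langlands-12919 of the LIVE route SkinnerWilesDefectOne).  The child route `EllipticTraceSplit` (born 2026-08-31T02:50:34Z,
`--refines route-Langlands-SymmetryTypeSplit:GenericProModular`; lens-2-g19 NODE REV 1, crit-1 CLEARED row 275, of-record row 277) cuts GEN
EXACTLY into ELL = `Theses.EllipticTraceSplit.EllipticGenericProModular` (stmt-Langlands-27585, crux 2, ATTACKABLE: the twist-saturated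
elliptic-trace box EBOX(F,p,ρ) — `X₀(15)(F)` finite and `ρ = ν ⊗ ρ₁`, `ν` of finite order, `ρ₁` with the Frobenius polynomials of a non-CM
Weierstrass model over `𝓞 F` a.e.) and NEL = `Theses.EllipticTraceSplit.NonEllipticGenericProModular` (stmt-Langlands-27586, declared residual
3, BARRIER `ResiduallyReducibleBarrier_holds`).  This file is the census KERNEL TWIN of the node (lens file
`HOME/nodes/lens-2-g19-EllipticTraceSplit.lean`, sha256 ff5c76dc…): every kernel is re-proved here AGAINST THE BORN ROUTE DECLS BY NAME —
exactness `gen_iff_cells : GEN ⟺ ELL ∧ NEL` (through the route's own deciding theorem `Theses.EllipticTraceSplit.closes`), necessity from GEN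
and from the host blocker E, the chain to E through the born parent, the twist-saturation certificate `ebox_twist_closed` (critic o1, row 269),
the layer-2 sorting of NEL, and the ENGINE `elliptic_of_caraianiNewton_of_dictionary_of_twist : CaraianiNewton2023_modularity →
EllipticDictionary → TwistTransport → ELL` (a CONDITIONAL result: the tree's named fact for Caraiani–Newton 2023 Thm 1.1 plus the two
junction schemas below, which are definitions of this file, NOT items and NOT Literature facts).

## Census second read of the junction schemas (instrument I-g19.1 / I-g19.2, census-1 g25; rule p1 of crit-1 row 255: a seat-assembled
## print-adjacent schema is read by an independent second reader BEFORE any Literature edit)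

Tree conventions checked (all mutually consistent): `FramedGaloisRep.HasFrobCharpolyAt` = ARITHMETIC Frobenius (GaloisRep.lean §Frobenius);
`BigHeckeGLn.IsAssociatedFamily` = unramified at EVERY `v ∉ bad` with `charpoly ρ(Frob_v) = heckeFrobPoly 2 q_v (x(T_{v,·})) = X² − x(T_{v,1})X
+ q_v·x(T_{v,2})` [GeeNewton2020 §3.3 Conj. 3.3.2]; `TameLevel.bad` = ANY finite set of finite places containing the places above `p`, the level
hyperspecial and factorizable outside it (so the lens's open point K2 «which bad sets `TameLevel 2 F p` admits» has the answer: all of them —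
no obstruction, the ∃𝒰 absorbs the ramification of π, of ν and of E); `AutomorphicRepData.HasSatakeParamAt` = UNITARY normalisation
(`[K t_{v,i} K] ↦ q_v^{i(n−i)/2} e_i(α)`, so `T_{w,1} ↦ √q_w(α_w+β_w)` and `T_{w,2} ↦ α_wβ_w = ω_π(ϖ_w)`); `frobTraceAt E w = q_w + 1 − #E(k_w)`;
`IsModularEllipticCurve F E` = CM ∨ ∃ weight-zero cuspidal π with `√q_w·Σα_w = a_w(E)` for cofinitely many w — the TRACE shadow only, whereas
the source defines «modular» by EQUALITY OF L-FUNCTIONS («there exists a cuspidal automorphic representation π of GL₂(𝔸_F) of parallel weight 2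
whose associated L-function is the same as the L-function of E», Caraiani–Newton p. 2 [corpus:paper:arxiv-2301.10509 p2]), which also pins
`α_wβ_w = 1`.

VERDICT I-g19.1 (`EllipticDictionary`, as typed below): TRUE IN PRINT, print-adjacent (no single printed sentence), NOT a by-name fact of the
tree; the proof carries two loads the lens memo (§7: Eichler–Shimura–Harder, Franke 1998, GeeNewton2020 §2.1) does not list:
(L1) CENTRAL CHARACTER — association needs `x(T_{w,2}) = 1`, i.e. `ω_π = 1`, which the trace-only π-clause does not say; in print it follows
from the Galois representations attached to weight-zero cuspidal π over an imaginary quadratic field (Taylor 1994 + Berger–Harcos 2007, or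
Harris–Lan–Taylor–Thorne 2016 Thm A / Scholze 2015 Cor. V.4.2: `charpoly ρ_{π,ι}(Frob_w) = X² − t_wX + q_wω_π(ϖ_w)` a.e.) compared with the
hypothesis `charpoly ρ(Frob_w) = X² − a_w(E)X + q_w` by Chebotarev density + continuity + Brauer–Nesbitt (`ρ_{π,ι}^ss ≅ ρ^ss`, so `q_wω_π(ϖ_w) =
q_w` a.e., so `ω_π = 1`); (L2) RAMIFICATION — the schema assumes neither `∀ᶠ v, ρ.IsUnramifiedAt v` nor `¬ HasCM`, but association demands
unramifiedness at every `v ∉ bad` (and `HasFrobCharpolyAt` does not imply it in rank 2, see its docstring; continuous p-adic representations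
ramified at infinitely many places exist, Khare–Larsen–Ramakrishnan 2005): for non-CM E (and CM by K′ ≠ F) `ρ^ss ≅ V_pE ⊗ ℚ̄_p` is irreducible
(Faltings), so `ρ ≅ V_pE ⊗ ℚ̄_p` is unramified outside `p·𝔣(E)`; for CM by F itself the π-clause is VACUOUS (a cuspidal π with `ρ_{π,ι}^ss =
ψ₁ ⊕ ψ₂` would give the partial `L^S(s, π × (ψ₁/|ψ₁|)⁻¹)` a pole at `s = 1` from `ζ_F^S`, against Jacquet–Shalika/Godement–Jacquet entireness —
again through (L1)'s Galois input).  Then: π cuspidal cohomological (trivial coefficients) ⟹ its eigensystem occurs in `H¹(X_U, ℂ)` (Harder 1987,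
Eichler–Shimura for Bianchi groups; Borel/Franke 1998) ⟹ via ι in `H¹(X_U, ℤ_p) ⊗ ℚ̄_p` ⟹ a continuous `ℚ̄_p`-point `x` of `𝕋(U^p)` with
`x(T_{w,1}) = a_w(E)`, `x(T_{w,2}) = 1` for `w ∉ bad ⊇ {v ∣ p} ∪ 𝔣(E) ∪ 𝔣(π)` [GeeNewton2020 §2.1.3, Def. 2.1.5/Rem. 2.1.6: `𝕋^S(U^p) →
End(H_*(𝒞(U_pU^p,s)))`], associated with `ρ ≅ V_pE ⊗ ℚ̄_p`.  RECOMMENDATION R-g25.1 (for the lens / a future vendoring, NOT applied here —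
the twin keeps the CLEARED REV-1 text verbatim): either add the hypotheses `¬ (E.baseChange F).HasCM` (available at the one call site: the box
supplies it) and `∀ᶠ v, ρ.IsUnramifiedAt v`, discharging (L2) for free, and/or strengthen the π-clause (and the Literature predicate
`IsModularEllipticCurve`) to the FULL Satake parameter (`√q_w·α.sum = a_w(E) ∧ α.prod = 1`, still a cofinite shadow of the source's L-function
equality), discharging (L1); as typed, a Literature version would have to cite HLTT16/Scholze15 besides Harder/Franke/Gee–Newton.

VERDICT I-g19.2 (`TwistTransport`, as typed below): TRUE IN PRINT in substance (twisting cohomology classes by the locally constant class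
`c_ν = ν ∘ Art ∘ det ∈ H⁰(X_{U′}, 𝓞)`, `ν` of finite order hence trivial on the connected `F_∞^× = ℂ^×` and on `F^×`, intertwines `T_{w,i}` with
`ν(ϖ_w)^{∓i}·T_{w,i}` for `w ∉ bad′ = bad ∪ 𝔣(ν)`; the Hecke–Frobenius polynomial of the twisted system is `charpoly (ν ⊗ ρ₁)(Frob_w)`), but NOT
printed for continuous `ℚ̄_p`-points of the big Hecke algebra as such; two technical loads: (T1) CHANGE OF TAME LEVEL `U′^p ⊂ U^p` for `𝕋^S(·)`
is printed (Gee–Newton 2020 Prop. 2.2.3 in the JIMJ numbering = arXiv Prop. 26 [corpus:paper:arxiv-1609.06965 p12]: «the surjection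
𝕋^{S∪Q}(U^p_0(Q)) ↠ 𝕋^{S∪Q}(U^p) comes from the splitting by the trace map … this index is prime to p») ONLY when `[U^p : U′^p]` is prime to `p`
— when `p` divides `#(𝓞_F/𝔣(ν))^×` the level-raising map of big Hecke algebras needs a separate (nilpotent-kernel / invert-p) argument for
points; (T2) the tree's `𝕋(𝒰)` is the closed Hecke subring of `∏ End(Hⁱ(X_{U_r}, ℤ/p^s))`, not Gee–Newton's derived-endomorphism limit, so the
twisting automorphism must be run on that product (cup product with `c_ν` over `𝓞 = ℤ_p[μ_N]`, `μ_N ∌` the values of ν in general).  Typer-sized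
(S/M) once a `TameLevel`-shrinking API exists; until then it is correctly a junction.  No Literature edit is proposed by the census (rule p1
satisfied: this is the second read; the first reader is lens-2-g19 memo §7).

Nothing here proves `Langlands`, E, GEN or ELL: the file records (i) that the born cut is exact and saturated, and (ii) exactly which two
print-adjacent schemas stand between the tree's Caraiani–Newton fact and the crux ELL.  Census-1 g25; `--supports stmt-Langlands-27585`.
-/

set_option linter.dupNamespace false -- project-wide option (lakefile weak.linter.dupNamespace); `Summit.Langlands.Langlands` is the mandated namespace

namespace Summit.Langlands.Langlands.Theorems.EllipticTraceSplit

open scoped NumberField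
open Filter IsDedekindDomain Literature.NumberTheory.GaloisRepresentations Literature.NumberTheory.Automorphic
open Summit.Langlands.Langlands.Theses.EllipticTraceSplit (EllipticGenericProModular NonEllipticGenericProModular)

/-- junction schema 1 (census instrument I-g19.1, NOT an item): a weight-zero cuspidal `π` of `GL₂(𝔸_F)` whose `T_w`-eigenvalues are
`a_w(E)` at almost all `w` (the automorphic alternative of `IsModularEllipticCurve F E`, verbatim) makes every framed
`ρ : Γ_F → GL₂(ℚ̄_p)` with `charpoly ρ(Frob_w) = X² − a_w(E)X + q_w` a.e. (hence `ρ ≅ V_p E`: Chebotarev + Brauer–Nesbitt, `V_p E`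
irreducible) `p`-adically automorphic of some tame level (`TameLevel.IsPadicallyAutomorphic`: a continuous `ℚ̄_p`-point of the
completed-cohomology Hecke algebra) — cohomological cusp forms are points of `𝕋(U^p)` [GeeNewton2020 §2.1; Franke 1998 / Harder 1987
(Eichler–Shimura for Bianchi groups)].  CENSUS SECOND READ (I-g19.1, g25, module docstring): TRUE IN PRINT as typed, with the
silent loads (L1) `ω_π = 1` via the Galois representations of π (HLTT 2016 / Scholze 2015 Cor. V.4.2) and (L2) ramification/irreducibility via
Faltings (non-CM) resp. vacuity (CM by F); recommendation R-g25.1 recorded there; lens text kept VERBATIM (REV 1, crit-1 CLEARED row 275). -/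
def EllipticDictionary : Prop :=
  ∀ (F : Type) [Field F] [NumberField F], NumberField.IsTotallyComplex F → Module.finrank ℚ F = 2 → ∀ (p : ℕ) [Fact p.Prime], p ≠ 2 → ∀ (ρ : Literature.NumberTheory.GaloisRepresentations.FramedGaloisRep F (PadicAlgCl p) 2) (E : WeierstrassCurve (NumberField.RingOfIntegers F)), E.Δ ≠ 0 → (∀ᶠ w : IsDedekindDomain.HeightOneSpectrum (NumberField.RingOfIntegers F) in Filter.cofinite, ρ.HasFrobCharpolyAt w (Polynomial.X ^ 2 - Polynomial.C ((Literature.NumberTheory.Automorphic.frobTraceAt E w : ℤ) : PadicAlgCl p) * Polynomial.X + Polynomial.C ((w.residueCard : ℕ) : PadicAlgCl p))) → (∃ (hF : Literature.NumberTheory.Automorphic.isCompact_glFiniteIntegralLevel 2 F) (π : Literature.NumberTheory.Automorphic.CuspidalAutomorphicRepData 2 F hF), π.1.HasWeightZero ∧ ∀ᶠ w : IsDedekindDomain.HeightOneSpectrum (NumberField.RingOfIntegers F) in Filter.cofinite, ∃ α : Multiset ℂ, π.1.HasSatakeParamAt w α ∧ ((Real.sqrt w.residueCard : ℝ) : ℂ)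 * α.sum = (Literature.NumberTheory.Automorphic.frobTraceAt E w : ℂ)) → ∃ 𝒰 : Literature.NumberTheory.Automorphic.BigHeckeGLn.TameLevel 2 F p, 𝒰.IsPadicallyAutomorphic ρ

/-- junction schema 2 (census instrument I-g19.2, NOT an item): `p`-adic automorphy of some tame level is stable under twisting by a
continuous character `ν : Γ_F → ℚ̄_pˣ` of FINITE order — on completed cohomology of a tame level small enough for `ν ∘ Art`, the
eigensystem `T_w ↦ ν(Frob_w)·T_w` is again a continuous point [GeeNewton2020 §2.1.1 (functoriality of `𝕋(U^p)` in `U^p`); standard].  CENSUS SECOND READ (I-g19.2, g25, module docstring): TRUE IN PRINT in substance; loads (T1) change of tame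
level for `𝕋^S(·)` is printed only for index prime to `p` (Gee–Newton 2020 Prop. 2.2.3, trace splitting) and (T2) the twisting automorphism must be
run on the tree's product-of-`End` model of `𝕋(𝒰)`; typer-sized once a `TameLevel`-shrinking API exists; lens text kept VERBATIM. -/
def TwistTransport : Prop :=
  ∀ (F : Type) [Field F] [NumberField F], NumberField.IsTotallyComplex F → Module.finrank ℚ F = 2 → ∀ (p : ℕ) [Fact p.Prime], p ≠ 2 → ∀ (ρ ρ₁ : Literature.NumberTheory.GaloisRepresentations.FramedGaloisRep F (PadicAlgCl p) 2) (ν : Field.absoluteGaloisGroup F →ₜ* (PadicAlgCl p)ˣ), (∃ n : ℕ, 0 < n ∧ ∀ σ, ν σ ^ n = 1) → (∀ σ : Field.absoluteGaloisGroup F, (ρ σ).val = ((ν σ : (PadicAlgCl p)ˣ) : PadicAlgCl p) • (ρ₁ σ).val) → (∃ 𝒰 : Literature.NumberTheory.Automorphic.BigHeckeGLn.TameLevel 2 F p, 𝒰.IsPadicallyAutomorphic ρ₁) → ∃ 𝒰 : Literature.NumberTheory.Automorphic.BigHeckeGLn.TameLevel 2 F p, 𝒰.IsPadicallyAutomorphic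 ρ

/-- layer-2 piece of NEL (stub text; NOT an item): (twisted-)elliptic `ρ` over an imaginary quadratic `F` with `X₀(15)(F)` INFINITE —
exactly the case Caraiani–Newton 2023 leave open (p. 2–3: the 15-torsion analysis).  Named open problem, strictly weaker than NEL. -/
def InfiniteX0FifteenEllipticProModular : Prop :=
  ∀ (F : Type) [Field F] [NumberField F], NumberField.IsTotallyComplex F → Module.finrank ℚ F = 2 → ∀ (p : ℕ) [Fact p.Prime], p ≠ 2 → ∀ (O : ValuationSubring (PadicAlgCl p)), O = (Valued.v : Valuation (PadicAlgCl p) NNReal).valuationSubring → ∀ (ρ : Literature.NumberTheory.GaloisRepresentations.FramedGaloisRep F (PadicAlgCl p) 2) (ρ₀ : Field.absoluteGaloisGroup F →* Matrix.GeneralLinearGroup (Fin 2) O), ρ.toGaloisRep.IsIrreducible → (∀ᶠ v in cofinite, ρ.IsUnramifiedAt v) → ρ.HasUpperTriangularIntegralModel ρ₀ → (∃ k : ℕ, 2 ≤ k ∧ ∃ m : ℕ, 0 < m ∧ ∀ v : IsDedekindDomain.HeightOneSpectrum (NumberField.RingOfIntegers F), (p : NumberField.RingOfIntegers F) ∈ v.asIdeal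 → Literature.NumberTheory.GaloisRepresentations.IsPDistinguishedAt ρ₀ v ∧ ∃ Q : Matrix.GeneralLinearGroup (Fin 2) (PadicAlgCl p), Valued.v (Q.val 0 0) ≤ Valued.v (Q.val 1 0) ∧ ∀ σ, (Q⁻¹ * ρ.toLocal v σ * Q).val 1 0 = 0 ∧ (σ ∈ Literature.NumberTheory.GaloisRepresentations.absInertia (v.adicCompletion F) → (Q⁻¹ * ρ.toLocal v σ * Q).val 1 1 ^ m = 1 ∧ (Q⁻¹ * ρ.toLocal v σ * Q).val 0 0 ^ m = algebraMap (Padic p) (PadicAlgCl p) (((Literature.NumberTheory.GaloisRepresentations.GaloisRep.cyclotomicCharacter (v.adicCompletion F) p σ).val : PadicInt p) : Padic p) ^ ((k - 1) * m))) → ¬ (∃ (η : Field.absoluteGaloisGroup F →ₜ* (PadicAlgCl p)ˣ) (P : Matrix.GeneralLinearGroup (Fin 2) (PadicAlgCl p)), (∃ σ : Field.absoluteGaloisGroup F, η σ ≠ 1) ∧ ∀ σ : Field.absoluteGaloisGroup F, ((η σ : (PadicAlgCl p)ˣ) : PadicAlgCl p) • (ρ σ).val = (P * ρ σ * P⁻¹).val)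 → ¬ (∃ (ρ' : Literature.NumberTheory.GaloisRepresentations.FramedGaloisRep ℚ (PadicAlgCl p) 2) (ν : Field.absoluteGaloisGroup F →ₜ* (PadicAlgCl p)ˣ), ρ'.IsOdd ∧ (∃ n : ℕ, 0 < n ∧ ∀ σ, ν σ ^ n = 1) ∧ ∀ σ : Field.absoluteGaloisGroup F, (ρ σ).val = ((ν σ : (PadicAlgCl p)ˣ) : PadicAlgCl p) • (ρ' (Literature.NumberTheory.GaloisRepresentations.absGaloisRestrict ℚ F σ)).val) → ¬ Finite (Literature.NumberTheory.Automorphic.X0FifteenLegendre.baseChange F).toAffine.Point → (∃ (E : WeierstrassCurve (NumberField.RingOfIntegers F)) (ν : Field.absoluteGaloisGroup F →ₜ* (PadicAlgCl p)ˣ) (ρ₁ : Literature.NumberTheory.GaloisRepresentations.FramedGaloisRep F (PadicAlgCl p) 2), E.Δ ≠ 0 ∧ ¬ (E.baseChange F).HasCM ∧ (∃ n : ℕ, 0 < n ∧ ∀ σ, ν σ ^ n = 1) ∧ (∀ᶠ w : IsDedekindDomain.HeightOneSpectrum (NumberField.RingOfIntegers F) in Filter.cofinite, ρ₁.HasFrobCharpolyAt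 w (Polynomial.X ^ 2 - Polynomial.C ((Literature.NumberTheory.Automorphic.frobTraceAt E w : ℤ) : PadicAlgCl p) * Polynomial.X + Polynomial.C ((w.residueCard : ℕ) : PadicAlgCl p))) ∧ ∀ σ : Field.absoluteGaloisGroup F, (ρ σ).val = ((ν σ : (PadicAlgCl p)ˣ) : PadicAlgCl p) • (ρ₁ σ).val) → ∃ 𝒰 : Literature.NumberTheory.Automorphic.BigHeckeGLn.TameLevel 2 F p, 𝒰.IsPadicallyAutomorphic ρ

/-- layer-2 piece of NEL (stub text; NOT an item): `ρ` is NO finite-order twist of a `ρ₁` matching a non-CM Weierstrass model over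
`𝓞 F` (irrational Frobenius field, weight `k ≥ 3`, …) — the residual proper.  Strictly weaker than NEL. -/
def NonEllipticTraceProModular : Prop :=
  ∀ (F : Type) [Field F] [NumberField F], NumberField.IsTotallyComplex F → Module.finrank ℚ F = 2 → ∀ (p : ℕ) [Fact p.Prime], p ≠ 2 → ∀ (O : ValuationSubring (PadicAlgCl p)), O = (Valued.v : Valuation (PadicAlgCl p) NNReal).valuationSubring → ∀ (ρ : Literature.NumberTheory.GaloisRepresentations.FramedGaloisRep F (PadicAlgCl p) 2) (ρ₀ : Field.absoluteGaloisGroup F →* Matrix.GeneralLinearGroup (Fin 2) O), ρ.toGaloisRep.IsIrreducible → (∀ᶠ v in cofinite, ρ.IsUnramifiedAt v) → ρ.HasUpperTriangularIntegralModel ρ₀ → (∃ k : ℕ, 2 ≤ k ∧ ∃ m : ℕ, 0 < m ∧ ∀ v : IsDedekindDomain.HeightOneSpectrum (NumberField.RingOfIntegers F), (p : NumberField.RingOfIntegers F) ∈ v.asIdeal → Literature.NumberTheory.GaloisRepresentations.IsPDistinguishedAt ρ₀ v ∧ ∃ Q : Matrix.GeneralLinearGroup (Fin 2) (PadicAlgCl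 p), Valued.v (Q.val 0 0) ≤ Valued.v (Q.val 1 0) ∧ ∀ σ, (Q⁻¹ * ρ.toLocal v σ * Q).val 1 0 = 0 ∧ (σ ∈ Literature.NumberTheory.GaloisRepresentations.absInertia (v.adicCompletion F) → (Q⁻¹ * ρ.toLocal v σ * Q).val 1 1 ^ m = 1 ∧ (Q⁻¹ * ρ.toLocal v σ * Q).val 0 0 ^ m = algebraMap (Padic p) (PadicAlgCl p) (((Literature.NumberTheory.GaloisRepresentations.GaloisRep.cyclotomicCharacter (v.adicCompletion F) p σ).val : PadicInt p) : Padic p) ^ ((k - 1) * m))) → ¬ (∃ (η : Field.absoluteGaloisGroup F →ₜ* (PadicAlgCl p)ˣ) (P : Matrix.GeneralLinearGroup (Fin 2) (PadicAlgCl p)), (∃ σ : Field.absoluteGaloisGroup F, η σ ≠ 1) ∧ ∀ σ : Field.absoluteGaloisGroup F, ((η σ : (PadicAlgCl p)ˣ) : PadicAlgCl p) • (ρ σ).val = (P * ρ σ * P⁻¹).val) → ¬ (∃ (ρ' : Literature.NumberTheory.GaloisRepresentations.FramedGaloisRep ℚ (PadicAlgCl p) 2) (ν : Field.absoluteGaloisGroup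 F →ₜ* (PadicAlgCl p)ˣ), ρ'.IsOdd ∧ (∃ n : ℕ, 0 < n ∧ ∀ σ, ν σ ^ n = 1) ∧ ∀ σ : Field.absoluteGaloisGroup F, (ρ σ).val = ((ν σ : (PadicAlgCl p)ˣ) : PadicAlgCl p) • (ρ' (Literature.NumberTheory.GaloisRepresentations.absGaloisRestrict ℚ F σ)).val) → ¬ (∃ (E : WeierstrassCurve (NumberField.RingOfIntegers F)) (ν : Field.absoluteGaloisGroup F →ₜ* (PadicAlgCl p)ˣ) (ρ₁ : Literature.NumberTheory.GaloisRepresentations.FramedGaloisRep F (PadicAlgCl p) 2), E.Δ ≠ 0 ∧ ¬ (E.baseChange F).HasCM ∧ (∃ n : ℕ, 0 < n ∧ ∀ σ, ν σ ^ n = 1) ∧ (∀ᶠ w : IsDedekindDomain.HeightOneSpectrum (NumberField.RingOfIntegers F) in Filter.cofinite, ρ₁.HasFrobCharpolyAt w (Polynomial.X ^ 2 - Polynomial.C ((Literature.NumberTheory.Automorphic.frobTraceAt E w : ℤ) : PadicAlgCl p) * Polynomial.X + Polynomial.C ((w.residueCard : ℕ) : PadicAlgCl p))) ∧ ∀ σ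 : Field.absoluteGaloisGroup F, (ρ σ).val = ((ν σ : (PadicAlgCl p)ˣ) : PadicAlgCl p) • (ρ₁ σ).val) → ∃ 𝒰 : Literature.NumberTheory.Automorphic.BigHeckeGLn.TameLevel 2 F p, 𝒰.IsPadicallyAutomorphic ρ

/-! ## Text identity with the tree and EXACTNESS -/

/-- GEN, by name, is literally its tree text (rev 0 of `Theses/SymmetryTypeSplit.lean`). -/
theorem gen_text_iff : Summit.Langlands.Langlands.Theses.SymmetryTypeSplit.GenericProModular ↔ (∀ (F : Type) [Field F] [NumberField F], NumberField.IsTotallyComplex F → Module.finrank ℚ F = 2 → ∀ (p : ℕ) [Fact p.Prime], p ≠ 2 → ∀ (O : ValuationSubring (PadicAlgCl p)), O = (Valued.v : Valuation (PadicAlgCl p) NNReal).valuationSubring → ∀ (ρ : Literature.NumberTheory.GaloisRepresentations.FramedGaloisRep F (PadicAlgCl p) 2) (ρ₀ : Field.absoluteGaloisGroup F →* Matrix.GeneralLinearGroup (Fin 2) O), ρ.toGaloisRep.IsIrreducible → (∀ᶠ v in cofinite, ρ.IsUnramifiedAt v) → ρ.HasUpperTriangularIntegralModel ρ₀ → (∃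 k : ℕ, 2 ≤ k ∧ ∃ m : ℕ, 0 < m ∧ ∀ v : IsDedekindDomain.HeightOneSpectrum (NumberField.RingOfIntegers F), (p : NumberField.RingOfIntegers F) ∈ v.asIdeal → Literature.NumberTheory.GaloisRepresentations.IsPDistinguishedAt ρ₀ v ∧ ∃ Q : Matrix.GeneralLinearGroup (Fin 2) (PadicAlgCl p), Valued.v (Q.val 0 0) ≤ Valued.v (Q.val 1 0) ∧ ∀ σ, (Q⁻¹ * ρ.toLocal v σ * Q).val 1 0 = 0 ∧ (σ ∈ Literature.NumberTheory.GaloisRepresentations.absInertia (v.adicCompletion F) → (Q⁻¹ * ρ.toLocal v σ * Q).val 1 1 ^ m = 1 ∧ (Q⁻¹ * ρ.toLocal v σ * Q).val 0 0 ^ m = algebraMap (Padic p) (PadicAlgCl p) (((Literature.NumberTheory.GaloisRepresentations.GaloisRep.cyclotomicCharacter (v.adicCompletion F) p σ).val : PadicInt p) : Padic p) ^ ((k - 1) * m))) → ¬ (∃ (η : Field.absoluteGaloisGroup F →ₜ* (PadicAlgCl p)ˣ) (P : Matrix.GeneralLinearGroup (Fin 2) (PadicAlgCl p)), (∃ σ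 : Field.absoluteGaloisGroup F, η σ ≠ 1) ∧ ∀ σ : Field.absoluteGaloisGroup F, ((η σ : (PadicAlgCl p)ˣ) : PadicAlgCl p) • (ρ σ).val = (P * ρ σ * P⁻¹).val) → ¬ (∃ (ρ' : Literature.NumberTheory.GaloisRepresentations.FramedGaloisRep ℚ (PadicAlgCl p) 2) (ν : Field.absoluteGaloisGroup F →ₜ* (PadicAlgCl p)ˣ), ρ'.IsOdd ∧ (∃ n : ℕ, 0 < n ∧ ∀ σ, ν σ ^ n = 1) ∧ ∀ σ : Field.absoluteGaloisGroup F, (ρ σ).val = ((ν σ : (PadicAlgCl p)ˣ) : PadicAlgCl p) • (ρ' (Literature.NumberTheory.GaloisRepresentations.absGaloisRestrict ℚ F σ)).val) → ∃ 𝒰 : Literature.NumberTheory.Automorphic.BigHeckeGLn.TameLevel 2 F p, 𝒰.IsPadicallyAutomorphic ρ) := Iff.rfl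

/-- necessity: GEN ⟹ ELL (drop the box hypothesis). -/
theorem elliptic_of_generic (h : Summit.Langlands.Langlands.Theses.SymmetryTypeSplit.GenericProModular) : EllipticGenericProModular := by
  intro F _ _ hF hd p _ hp O hO ρ ρ₀ hirr hunr hint hord hns hno _
  exact h F hF hd p hp O hO ρ ρ₀ hirr hunr hint hord hns hno

/-- necessity: GEN ⟹ NEL. -/
theorem nonElliptic_of_generic (h : Summit.Langlands.Langlands.Theses.SymmetryTypeSplit.GenericProModular) : NonEllipticGenericProModular := by
  intro F _ _ hF hd p _ hp O hO ρ ρ₀ hirr hunr hint hord hns hno _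
  exact h F hF hd p hp O hO ρ ρ₀ hirr hunr hint hord hns hno


/-- EXACTNESS: GEN ⟺ ELL ∧ NEL (the cut loses nothing). -/
theorem gen_iff_cells : Summit.Langlands.Langlands.Theses.SymmetryTypeSplit.GenericProModular ↔ (EllipticGenericProModular ∧ NonEllipticGenericProModular) :=
  ⟨fun h => ⟨elliptic_of_generic h, nonElliptic_of_generic h⟩, fun h => Summit.Langlands.Langlands.Theses.EllipticTraceSplit.closes h.1 h.2⟩

/-- necessity from the host BLOCKER E (stmt-Langlands-12919) BY NAME: E ⟹ ELL. -/
theorem elliptic_of_engine (h : Summit.Langlands.Langlands.Theses.SkinnerWilesDefectOne.ReducibleOrdinaryProModular) : EllipticGenericProModular := by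
  intro F _ _ hF hd p _ hp O hO ρ ρ₀ hirr hunr hint hord _ _ _
  exact h F hF hd p hp O hO ρ ρ₀ hirr hunr hint hord

/-- necessity from E BY NAME: E ⟹ NEL. -/
theorem nonElliptic_of_engine (h : Summit.Langlands.Langlands.Theses.SkinnerWilesDefectOne.ReducibleOrdinaryProModular) : NonEllipticGenericProModular := by
  intro F _ _ hF hd p _ hp O hO ρ ρ₀ hirr hunr hint hord _ _ _
  exact h F hF hd p hp O hO ρ ρ₀ hirr hunr hint hord

/-- the chain to the host BLOCKER through the born route `SymmetryTypeSplit`: CM → OBC → ELL → NEL → E (stmt-Langlands-12919). -/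
theorem closes_via_parent (hcm : Summit.Langlands.Langlands.Theses.SymmetryTypeSplit.CMProModular) (hobc : Summit.Langlands.Langlands.Theses.SymmetryTypeSplit.OddDescentProModular) (h₁ : EllipticGenericProModular)
    (h₂ : NonEllipticGenericProModular) : Summit.Langlands.Langlands.Theses.SkinnerWilesDefectOne.ReducibleOrdinaryProModular :=
  Summit.Langlands.Langlands.Theses.SymmetryTypeSplit.closes hcm hobc (Summit.Langlands.Langlands.Theses.EllipticTraceSplit.closes h₁ h₂)

/-! ## The ENGINE of the elliptic cell: Caraiani–Newton 2023 (tree named fact) + the two junctions -/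

/-- **ELL from print**: `CaraianiNewton2023_modularity` (Thm 1.1, accepted named fact of the tree) and the junction schemas
`EllipticDictionary`, `TwistTransport` prove the elliptic cell.  For a member `ρ = ν ⊗ ρ₁` of the box, CN23 gives
`IsModularEllipticCurve F E`; the CM alternative is excluded by the box; the automorphic alternative is fed to the dictionary for `ρ₁`,
and the twist junction carries `p`-adic automorphy from `ρ₁` to `ρ`. -/
theorem elliptic_of_caraianiNewton_of_dictionary_of_twist (hCN : Literature.NumberTheory.Automorphic.CaraianiNewton2023_modularity) (hD : EllipticDictionary)
    (hT : TwistTransport) : EllipticGenericProModular := by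
  intro F _ _ hF hd p _ hp O hO ρ ρ₀ hirr hunr hint hord hns hno hb
  obtain ⟨hfin, E, ν, ρ₁, hΔ, hncm, hν, hE, htw⟩ := hb
  rcases hCN F hF hd hfin E hΔ with hcm | hπ
  · exact absurd hcm hncm
  · exact hT F hF hd p hp ρ ρ₁ ν hν htw (hD F hF hd p hp ρ₁ E hΔ hE hπ)

/-- GEN modulo print + junctions is exactly its non-elliptic cell. -/
theorem generic_of_caraianiNewton_of_junctions_of_nonElliptic (hCN : Literature.NumberTheory.Automorphic.CaraianiNewton2023_modularity) (hD : EllipticDictionary)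
    (hT : TwistTransport) (h₂ : NonEllipticGenericProModular) : Summit.Langlands.Langlands.Theses.SymmetryTypeSplit.GenericProModular :=
  Summit.Langlands.Langlands.Theses.EllipticTraceSplit.closes (elliptic_of_caraianiNewton_of_dictionary_of_twist hCN hD hT) h₂

/-! ## Twist-saturation certificate (critic o1): a finite-order twist of a member of the box is a member of the box -/

/-- the curve clause of the dial is closed under finite-order twists: if `ρ' σ = χ σ • ρ σ` with `χ` of finite order and `ρ` is a
finite-order twist of an elliptic `ρ₁`, then so is `ρ'` (with character `χ * ν`).  Pure algebra in the commutative group `ℚ̄_pˣ`. -/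
theorem curve_twist_closed {F : Type} [Field F] [NumberField F] {p : ℕ} [Fact p.Prime]
    (ρ ρ' : Literature.NumberTheory.GaloisRepresentations.FramedGaloisRep F (PadicAlgCl p) 2) (χ : Field.absoluteGaloisGroup F →ₜ* (PadicAlgCl p)ˣ)
    (hχ : ∃ n : ℕ, 0 < n ∧ ∀ σ, χ σ ^ n = 1)
    (hrel : ∀ σ : Field.absoluteGaloisGroup F, (ρ' σ).val = ((χ σ : (PadicAlgCl p)ˣ) : PadicAlgCl p) • (ρ σ).val)
    (h : (∃ (E : WeierstrassCurve (NumberField.RingOfIntegers F)) (ν : Field.absoluteGaloisGroup F →ₜ* (PadicAlgCl p)ˣ) (ρ₁ : Literature.NumberTheory.GaloisRepresentations.FramedGaloisRep F (PadicAlgCl p) 2), E.Δ ≠ 0 ∧ ¬ (E.baseChange F).HasCM ∧ (∃ n : ℕ, 0 < n ∧ ∀ σ, ν σ ^ n = 1) ∧ (∀ᶠ w : IsDedekindDomain.HeightOneSpectrum (NumberField.RingOfIntegers F) in Filter.cofinite, ρ₁.HasFrobCharpolyAt w (Polynomial.X ^ 2 - Polynomial.C ((Literature.NumberTheory.Automorphic.frobTraceAt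 E w : ℤ) : PadicAlgCl p) * Polynomial.X + Polynomial.C ((w.residueCard : ℕ) : PadicAlgCl p))) ∧ ∀ σ : Field.absoluteGaloisGroup F, (ρ σ).val = ((ν σ : (PadicAlgCl p)ˣ) : PadicAlgCl p) • (ρ₁ σ).val)) :
    (∃ (E : WeierstrassCurve (NumberField.RingOfIntegers F)) (ν : Field.absoluteGaloisGroup F →ₜ* (PadicAlgCl p)ˣ) (ρ₁ : Literature.NumberTheory.GaloisRepresentations.FramedGaloisRep F (PadicAlgCl p) 2), E.Δ ≠ 0 ∧ ¬ (E.baseChange F).HasCM ∧ (∃ n : ℕ, 0 < n ∧ ∀ σ, ν σ ^ n = 1) ∧ (∀ᶠ w : IsDedekindDomain.HeightOneSpectrum (NumberField.RingOfIntegers F) in Filter.cofinite, ρ₁.HasFrobCharpolyAt w (Polynomial.X ^ 2 - Polynomial.C ((Literature.NumberTheory.Automorphic.frobTraceAt E w : ℤ) : PadicAlgCl p) * Polynomial.X + Polynomial.C ((w.residueCard : ℕ) : PadicAlgCl p))) ∧ ∀ σ : Field.absoluteGaloisGroup F, (ρ' σ).val = ((ν σ : (PadicAlgCl p)ˣ)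 : PadicAlgCl p) • (ρ₁ σ).val) := by
  obtain ⟨E, ν, ρ₁, hΔ, hncm, ⟨m, hm, hνm⟩, hE, htw⟩ := h
  obtain ⟨n, hn, hχn⟩ := hχ
  refine ⟨E, χ * ν, ρ₁, hΔ, hncm, ⟨n * m, Nat.mul_pos hn hm, fun σ => ?_⟩, hE, fun σ => ?_⟩
  · show (χ σ * ν σ) ^ (n * m) = 1
    rw [mul_pow, pow_mul, hχn, one_pow, one_mul, mul_comm n m, pow_mul, hνm, one_pow]
  · rw [hrel σ, htw σ, smul_smul]
    rfl

/-- hence the whole dial EBOX is twist-closed (the finiteness clause does not mention `ρ`). -/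
theorem ebox_twist_closed {F : Type} [Field F] [NumberField F] {p : ℕ} [Fact p.Prime]
    (ρ ρ' : Literature.NumberTheory.GaloisRepresentations.FramedGaloisRep F (PadicAlgCl p) 2) (χ : Field.absoluteGaloisGroup F →ₜ* (PadicAlgCl p)ˣ)
    (hχ : ∃ n : ℕ, 0 < n ∧ ∀ σ, χ σ ^ n = 1)
    (hrel : ∀ σ : Field.absoluteGaloisGroup F, (ρ' σ).val = ((χ σ : (PadicAlgCl p)ˣ) : PadicAlgCl p) • (ρ σ).val)
    (h : (Finite (Literature.NumberTheory.Automorphic.X0FifteenLegendre.baseChange F).toAffine.Point ∧ (∃ (E : WeierstrassCurve (NumberField.RingOfIntegers F)) (ν : Field.absoluteGaloisGroup F →ₜ* (PadicAlgCl p)ˣ) (ρ₁ : Literature.NumberTheory.GaloisRepresentations.FramedGaloisRep F (PadicAlgCl p) 2), E.Δ ≠ 0 ∧ ¬ (E.baseChange F).HasCM ∧ (∃ n : ℕ, 0 < n ∧ ∀ σ, ν σ ^ n = 1) ∧ (∀ᶠ w : IsDedekindDomain.HeightOneSpectrum (NumberField.RingOfIntegers F) in Filter.cofinite, ρ₁.HasFrobCharpolyAt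 w (Polynomial.X ^ 2 - Polynomial.C ((Literature.NumberTheory.Automorphic.frobTraceAt E w : ℤ) : PadicAlgCl p) * Polynomial.X + Polynomial.C ((w.residueCard : ℕ) : PadicAlgCl p))) ∧ ∀ σ : Field.absoluteGaloisGroup F, (ρ σ).val = ((ν σ : (PadicAlgCl p)ˣ) : PadicAlgCl p) • (ρ₁ σ).val))) : (Finite (Literature.NumberTheory.Automorphic.X0FifteenLegendre.baseChange F).toAffine.Point ∧ (∃ (E : WeierstrassCurve (NumberField.RingOfIntegers F)) (ν : Field.absoluteGaloisGroup F →ₜ* (PadicAlgCl p)ˣ) (ρ₁ : Literature.NumberTheory.GaloisRepresentations.FramedGaloisRep F (PadicAlgCl p) 2), E.Δ ≠ 0 ∧ ¬ (E.baseChange F).HasCM ∧ (∃ n : ℕ, 0 < n ∧ ∀ σ, ν σ ^ n = 1) ∧ (∀ᶠ w : IsDedekindDomain.HeightOneSpectrum (NumberField.RingOfIntegers F) in Filter.cofinite, ρ₁.HasFrobCharpolyAt w (Polynomial.X ^ 2 - Polynomial.C ((Literature.NumberTheory.Automorphic.frobTraceAt E w : ℤ) : PadicAlgCl p) * Polynomial.X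 + Polynomial.C ((w.residueCard : ℕ) : PadicAlgCl p))) ∧ ∀ σ : Field.absoluteGaloisGroup F, (ρ' σ).val = ((ν σ : (PadicAlgCl p)ˣ) : PadicAlgCl p) • (ρ₁ σ).val)) :=
  ⟨h.1, curve_twist_closed ρ ρ' χ hχ hrel h.2⟩

/-! ## Layer 2 of the residual cell (the statements of NEL's birth stubs) -/

/-- NEL from its two layer-2 pieces (kernel of the birth skeleton `birth_NonEllipticGenericProModular.lean`). -/
theorem nonElliptic_of_pieces (h₁ : InfiniteX0FifteenEllipticProModular) (h₂ : NonEllipticTraceProModular) :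
    NonEllipticGenericProModular := by
  intro F _ _ hF hd p _ hp O hO ρ ρ₀ hirr hunr hint hord hns hno hnb
  by_cases hc : (∃ (E : WeierstrassCurve (NumberField.RingOfIntegers F)) (ν : Field.absoluteGaloisGroup F →ₜ* (PadicAlgCl p)ˣ) (ρ₁ : Literature.NumberTheory.GaloisRepresentations.FramedGaloisRep F (PadicAlgCl p) 2), E.Δ ≠ 0 ∧ ¬ (E.baseChange F).HasCM ∧ (∃ n : ℕ, 0 < n ∧ ∀ σ, ν σ ^ n = 1) ∧ (∀ᶠ w : IsDedekindDomain.HeightOneSpectrum (NumberField.RingOfIntegers F) in Filter.cofinite, ρ₁.HasFrobCharpolyAt w (Polynomial.X ^ 2 - Polynomial.C ((Literature.NumberTheory.Automorphic.frobTraceAt E w : ℤ) : PadicAlgCl p) * Polynomial.X + Polynomial.C ((w.residueCard : ℕ) : PadicAlgCl p))) ∧ ∀ σ : Field.absoluteGaloisGroup F, (ρ σ).val = ((ν σ : (PadicAlgCl p)ˣ) : PadicAlgCl p) • (ρ₁ σ).val)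
  · have hnf : ¬ Finite (Literature.NumberTheory.Automorphic.X0FifteenLegendre.baseChange F).toAffine.Point := fun hf => hnb ⟨hf, hc⟩
    exact h₁ F hF hd p hp O hO ρ ρ₀ hirr hunr hint hord hns hno hnf hc
  · exact h₂ F hF hd p hp O hO ρ ρ₀ hirr hunr hint hord hns hno hc

/-- the pieces are consequences of NEL (so the layer-2 split is itself exact). -/
theorem pieces_of_nonElliptic (h : NonEllipticGenericProModular) :
    InfiniteX0FifteenEllipticProModular ∧ NonEllipticTraceProModular := by
  refine ⟨?_, ?_⟩
  · intro F _ _ hF hd p _ hp O hO ρ ρ₀ hirr hunr hint hord hns hno hnf hc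
    exact h F hF hd p hp O hO ρ ρ₀ hirr hunr hint hord hns hno (fun hb => hnf hb.1)
  · intro F _ _ hF hd p _ hp O hO ρ ρ₀ hirr hunr hint hord hns hno hc
    exact h F hF hd p hp O hO ρ ρ₀ hirr hunr hint hord hns hno (fun hb => hc hb.2)

/-- sanity (an `example`): the whole of GEN reduces to the residual proper modulo CN23, the two junctions and CN23's open case. -/
example (hCN : Literature.NumberTheory.Automorphic.CaraianiNewton2023_modularity) (hD : EllipticDictionary) (hT : TwistTransport) (h₁ : InfiniteX0FifteenEllipticProModular)
    (h₂ : NonEllipticTraceProModular) : Summit.Langlands.Langlands.Theses.SymmetryTypeSplit.GenericProModular :=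
  Summit.Langlands.Langlands.Theses.EllipticTraceSplit.closes (elliptic_of_caraianiNewton_of_dictionary_of_twist hCN hD hT) (nonElliptic_of_pieces h₁ h₂)

end Summit.Langlands.Langlands.Theorems.EllipticTraceSplit
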